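import Literature.Analysis.FluidPDE.PassiveScalarDiagFourier
import Literature.Analysis.FluidPDE.PerturbedEnergyGronwall
import Literature.Analysis.FunctionSpaces.TorusSobolevNormProofs
import Literature.Analysis.FunctionSpaces.DuBoisReymondAE
import HarnessLib

/-!
# Uniqueness of weak passive scalars with constant diagonal diffusion and BOUNDED drift
  (the `L^∞_t L²_x` class; every `κ > 0`, all `aᵢ > 0`; modewise energy bound + Grönwall)

Analysis/FluidPDE proof-support file (everything proved; no new definitions). For the
diagonal-diffusion passive scalar equation `∂ₜθ + u·∇θ = κ ∑ᵢ aᵢ ∂ᵢ∂ᵢθ (+ s)` on `T^d × [0,T)`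
(`Torus.IsWeakScalarTransportDiagOn`, `Torus.IsWeakScalarTransportDiagForcedOn`; the form the
isotropic equation on a rectangular torus `ℝ^d/⊕ᵢ Lᵢℤ` takes on the unit torus, `aᵢ = Lᵢ⁻²`,
Hess-Childs–Rowan: `a = (½, 1)`) with `κ > 0`, `aᵢ > 0` and a drift `u ∈ L^∞((0,T) × T^d)`:

* `Torus.IsWeakScalarTransportDiagOn.ae_eq_zero_of_memLp_top` — a weak solution in `L^∞_t L²_x`
  with datum `0` vanishes for a.e. `t`;
* `Torus.IsWeakScalarTransportDiagForcedOn.ae_eq_of_memLp_top` /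
  `Torus.IsWeakScalarTransportDiagOn.ae_eq_of_memLp_top` — **uniqueness**: two weak solutions in
  `L^∞_t L²_x` with the same drift, (source,) datum agree for a.e. `t ∈ (0,T)`. This is
  Bonicatto–Ciampa–Crippa 2024, Cor. 3.5 in the corner `p = ∞`, `q = 2` («there exists at most one
  distributional solution `u ∈ L^∞([0,T];L^q)`» for divergence-free `b ∈ L²_t L^p_x`,
  `1/p + 1/q ≤ 1/2`), transported to the diagonal operator (for `a ≡ 1` it is the tree's
  `IsWeakScalarTransportOn.ae_eq_of_memLp_top`, `PassiveScalarUniquenessBounded`).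

The proof does NOT go through the energy inequality / parabolic regularity of the class (the
source's route, Thm. 3.3 + Thm. 2.7; for the diagonal class that chain is not in the tree). Instead:
(1) the modewise integral equation (`PassiveScalarDiagFourier`):
`θ̂ₖ(t) = ∫_{(0,t]} (-νₖ θ̂ₖ - ∑ⱼ 2πi kⱼ (θuⱼ)^ₖ)`, `νₖ = 4π²κ ∑ᵢ aᵢkᵢ²`; (2) a one-mode energy bound
(`sq_norm_le_of_ae_eq_setIntegral`): the continuous representative `A` of `θ̂ₖ` satisfies
`|A(t)|² = ∫_{(0,t]} (-2νₖ|A|² + 2 Re(Ā βₖ))` by the product formula for primitives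
(`FunctionSpaces.mul_eq_add_setIntegral_of_eq_add_setIntegral`), and `-2ν|A|² + 2|A||β| ≤ |β|²/(2ν)`,
while `|βₖ|² ≤ 4π²|k|² ∑ⱼ |(θuⱼ)^ₖ|² ≤ (νₖ/(κ min aᵢ)) ∑ⱼ |(θuⱼ)^ₖ|²`, whence
`|θ̂ₖ(t)|² ≤ (2κ min aᵢ)⁻¹ ∫_{(0,t]} ∑ⱼ |(θuⱼ)^ₖ(τ)|² dτ` — uniformly in `k`, the point of the
argument; (3) summing over `k` (Plancherel, `Torus.tsum_enorm_sq_mFourierCoeff_eq_eLpNorm_sq`, and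
Tonelli) gives `‖θ(t)‖²_{L²} ≤ (d ‖u‖²_∞ /(2κ min aᵢ)) ∫₀ᵗ ‖θ‖²_{L²}` for a.e. `t`; (4) Grönwall a.e.
in time (`ae_gronwall_const`) gives `θ = 0`. No derivative of `u` and no regularity of `θ` beyond
the class are used. (For bounded drifts this is the classical `H⁻¹`-duality estimate behind the
uniqueness half of DiPerna–Lions 1989, Prop. II.1, written modewise.)

Cell `ad-ideate`, (P2) diag parabolic layer, item T1′ (uniqueness), planner `ad-p1` ROUND-11 §2.3;
consumers: the «unique solution `θ^κ`» sentences of `HessChildsRowan2025a_cor13`,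
`HessChildsRowan2025_cor12`, the MPS2025 BV-selection facts, route `SolenoidalFractalHomogenisation`.

## Mathlib / tree search

Tree: `PassiveScalarUniquenessBounded` (isotropic twin, via the energy inequality),
`PassiveScalarDiagFourier` (modewise identity), `DuBoisReymondAE` (product formula for primitives),
`PerturbedEnergyGronwall.ae_gronwall_const`, `TorusSobolevNormProofs` (Plancherel for honest `L²`
functions). `lean search 'IsWeakScalarTransportDiag.*ae_eq'`: nothing (2026-08-27).

## References

* P. Bonicatto, G. Ciampa, G. Crippa, *Weak and parabolic solutions of advection–diffusion
  equations with rough velocity field*, J. Evol. Equ. 24 (2024) 1 = arXiv:2306.15529, Cor. 3.5.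
  [`BonicattoCiampaCrippa2023`]
* R. J. DiPerna, P.-L. Lions, Invent. Math. 98 (1989), §II.1, Prop. II.1. [`DiPernaLions1989`]
* L. Grafakos, *Classical Fourier Analysis*, 3rd ed. (2014), Prop. 3.2.7 (1) (Plancherel). [`Grafakos2014`]
* L. C. Evans, *Partial Differential Equations*, 2nd ed. (AMS 2010), §7.1.2, Thm. 2 (Galerkin energy
  estimates) and App. B.2 (Grönwall). [`Evans2010`]
-/

noncomputable section

open MeasureTheory Set Filter Function TopologicalSpace Complex UnitAddTorus
open scoped ENNReal NNReal InnerProductSpace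

namespace Literature.Analysis.FluidPDE

/-! ## A one-mode energy bound: `|α(t)|² ≤ D ∫₀ᵗ γ` from `α' = -ν α + β`, `|β|² ≤ 2νDγ` -/

section ModeEnergy

/-- The elementary inequality behind the one-mode energy bound: for `ν > 0`,
`2x(-νx + p) ≤ p²/(2ν)` (complete the square: `(2νx - p)² ≥ 0`). [folklore] -/
private theorem two_mul_mul_le_sq_div {ν : ℝ} (hν : 0 < ν) (x p : ℝ) :
    2 * x * (-ν * x + p) ≤ p ^ 2 / (2 * ν) := by
  rw [le_div_iff₀ (by positivity)]
  nlinarith [sq_nonneg (p - 2 * ν * x)]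

/-- Pointwise step: if `‖b‖² ≤ 2νDc` with `ν, D, c ≥ 0`, then for every `A ∈ ℂ`,
`2 Re A · Re(-νA + b) + 2 Im A · Im(-νA + b) ≤ D c`. [folklore] -/
private theorem two_mul_re_add_two_mul_im_le {ν D c : ℝ} (hν : 0 ≤ ν) (hD : 0 ≤ D) (hc : 0 ≤ c)
    (A b : ℂ) (hb : ‖b‖ ^ 2 ≤ 2 * ν * D * c) :
    2 * A.re * (-(ν : ℂ) * A + b).re + 2 * A.im * (-(ν : ℂ) * A + b).im ≤ D * c := by
  have hre : (-(ν : ℂ) * A + b).re = -ν * A.re + b.re := by simp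
  have him : (-(ν : ℂ) * A + b).im = -ν * A.im + b.im := by simp
  rw [hre, him]
  have hb' : b.re ^ 2 + b.im ^ 2 ≤ 2 * ν * D * c := by
    rw [Complex.sq_norm, Complex.normSq_apply] at hb
    nlinarith [hb]
  rcases hν.eq_or_lt with h0 | hpos
  · -- `ν = 0`: then `b = 0`
    subst h0
    have h1 : b.re ^ 2 + b.im ^ 2 ≤ 0 := by simpa using hb'
    have hre0 : b.re = 0 := by nlinarith [sq_nonneg b.re, sq_nonneg b.im]
    have him0 : b.im = 0 := by nlinarith [sq_nonneg b.re, sq_nonneg b.im]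
    rw [hre0, him0]
    simp only [neg_zero, zero_mul, add_zero, mul_zero]
    exact mul_nonneg hD hc
  · have h1 := two_mul_mul_le_sq_div hpos A.re b.re
    have h2 := two_mul_mul_le_sq_div hpos A.im b.im
    have h3 : b.re ^ 2 / (2 * ν) + b.im ^ 2 / (2 * ν) ≤ D * c := by
      rw [← add_div, div_le_iff₀ (by positivity)]
      nlinarith [hb']
    linarith

/-- **One-mode energy bound.** Let `α, β : ℝ → ℂ` be integrable on `(0,T)`, `γ ≥ 0` integrable
on `(0,T)`, `ν ≥ 0`, `D ≥ 0`, with `α(t) = ∫_{(0,t]} (-ν α + β)` for a.e. `t ∈ (0,T)` (the mode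
equation with zero datum, integrated) and `‖β‖² ≤ 2νDγ` a.e. on `(0,T)`. Then
`‖α(t)‖² ≤ D ∫_{(0,t]} γ` for a.e. `t ∈ (0,T)`: the continuous representative
`A(t) = ∫_{(0,t]} (-ν α + β)` solves `A(t) = ∫_{(0,t]} (-ν A + β)` for every `t`, the product
formula for primitives (`FunctionSpaces.mul_eq_add_setIntegral_of_eq_add_setIntegral`) gives
`|A(t)|² = ∫_{(0,t]} (-2ν|A|² + 2 Re(Ā β))`, and `-2ν|A|² + 2|A||β| ≤ |β|²/(2ν) ≤ Dγ` (the energy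
estimate of one Galerkin mode, Evans 2010, §7.1.2, Thm. 2, Step 1). [cite: Evans2010, §7.1.2 Thm. 2] -/
theorem sq_norm_le_of_ae_eq_setIntegral {T ν D : ℝ} (hν : 0 ≤ ν) (hD : 0 ≤ D) {α β : ℝ → ℂ}
    {γ : ℝ → ℝ} (hα : IntegrableOn α (Ioo 0 T)) (hβ : IntegrableOn β (Ioo 0 T))
    (hγ : IntegrableOn γ (Ioo 0 T)) (hγ0 : ∀ᵐ s ∂(volume.restrict (Ioo 0 T)), 0 ≤ γ s)
    (heq : ∀ᵐ t ∂(volume.restrict (Ioo 0 T)), α t = ∫ s in Ioc 0 t, (-(ν : ℂ) * α s + β s))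
    (hbound : ∀ᵐ s ∂(volume.restrict (Ioo 0 T)), ‖β s‖ ^ 2 ≤ 2 * ν * D * γ s) :
    ∀ᵐ t ∂(volume.restrict (Ioo 0 T)), ‖α t‖ ^ 2 ≤ D * ∫ s in Ioc 0 t, γ s := by
  rcases le_or_gt T 0 with hT0 | hT0
  · rw [Ioo_eq_empty_of_le hT0, Measure.restrict_empty, ae_zero]
    exact Filter.eventually_bot
  -- the continuous representative
  set A : ℝ → ℂ := fun t => ∫ s in Ioc 0 t, (-(ν : ℂ) * α s + β s) with hA
  have hαA : ∀ᵐ t ∂(volume.restrict (Ioo 0 T)), α t = A t := heq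
  -- a.e. statements on `(0,T)` transfer to `(0,T]`
  have hT_ae : ∀ {p : ℝ → Prop}, (∀ᵐ s ∂(volume.restrict (Ioo 0 T)), p s) →
      ∀ᵐ s ∂(volume.restrict (Ioc 0 T)), p s := fun h => by
    rwa [← Measure.restrict_congr_set (Ioo_ae_eq_Ioc (μ := (volume : Measure ℝ)))]
  have hαA' : ∀ᵐ s ∂(volume.restrict (Ioc 0 T)), α s = A s := hT_ae hαA
  -- the integrand with `A` in place of `α`
  set φc : ℝ → ℂ := fun s => -(ν : ℂ) * A s + β s with hφc
  have hφc_ae : ∀ᵐ s ∂(volume.restrict (Ioo 0 T)), -(ν : ℂ) * α s + β s = φc s := by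
    filter_upwards [hαA] with s hs
    rw [hφc, hs]
  have hφci : IntegrableOn φc (Ioo 0 T) :=
    IntegrableOn.congr_fun_ae ((hα.const_mul _).add hβ) hφc_ae
  have hφciT : IntegrableOn φc (Ioc 0 T) := (integrableOn_Ioc_iff_integrableOn_Ioo (f := φc)).2 hφci
  -- `A(t) = ∫_{(0,t]} φc` for every `t ∈ (0,T]`
  have hAeq : ∀ t ∈ Ioc 0 T, A t = ∫ s in Ioc 0 t, φc s := by
    intro t ht
    rw [hA]
    refine setIntegral_congr_ae measurableSet_Ioc ?_
    have h1 : ∀ᵐ s ∂(volume : Measure ℝ), s ∈ Ioc 0 T → -(ν : ℂ) * α s + β s = φc s :=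
      (ae_restrict_iff' measurableSet_Ioc).1 (hT_ae hφc_ae)
    filter_upwards [h1] with s hs hst
    exact hs (Ioc_subset_Ioc_right ht.2 hst)
  -- real and imaginary parts
  set F : ℝ → ℝ := fun t => (A t).re with hF
  set G : ℝ → ℝ := fun t => (A t).im with hG
  set φ : ℝ → ℝ := fun s => (φc s).re with hφ
  set ψ : ℝ → ℝ := fun s => (φc s).im with hψ
  have hφi : IntegrableOn φ (Ioo 0 T) := hφci.re
  have hψi : IntegrableOn ψ (Ioo 0 T) := hφci.im
  have hFeq : ∀ t ∈ Ioc 0 T, F t = 0 + ∫ s in Ioc 0 t, φ s := by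
    intro t ht
    have hi : Integrable φc (volume.restrict (Ioc 0 t)) := hφciT.mono_set (Ioc_subset_Ioc_right ht.2)
    rw [zero_add, hF]
    simp only
    rw [hAeq t ht, hφ]
    have := integral_re hi
    simpa using this.symm
  have hGeq : ∀ t ∈ Ioc 0 T, G t = 0 + ∫ s in Ioc 0 t, ψ s := by
    intro t ht
    have hi : Integrable φc (volume.restrict (Ioc 0 t)) := hφciT.mono_set (Ioc_subset_Ioc_right ht.2)
    rw [zero_add, hG]
    simp only
    rw [hAeq t ht, hψ]
    have := integral_im hi
    simpa using this.symm
  -- the bound for the representative at every `t ∈ (0,T]`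
  have hAbound : ∀ t ∈ Ioc 0 T, ‖A t‖ ^ 2 ≤ D * ∫ s in Ioc 0 t, γ s := by
    intro t ht
    obtain ⟨i1, e1⟩ := FunctionSpaces.mul_eq_add_setIntegral_of_eq_add_setIntegral hφi hφi hFeq hFeq ht
    obtain ⟨i2, e2⟩ := FunctionSpaces.mul_eq_add_setIntegral_of_eq_add_setIntegral hψi hψi hGeq hGeq ht
    have hnorm : ‖A t‖ ^ 2 = F t * F t + G t * G t := by
      rw [Complex.sq_norm, Complex.normSq_apply]
    rw [hnorm, e1, e2, zero_mul, zero_add, zero_add, ← integral_add i1 i2]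
    have hγt : IntegrableOn γ (Ioc 0 t) :=
      ((integrableOn_Ioc_iff_integrableOn_Ioo (f := γ)).2 hγ).mono_set (Ioc_subset_Ioc_right ht.2)
    rw [← integral_const_mul]
    refine integral_mono_ae (i1.add i2) (hγt.const_mul D) ?_
    have hb : ∀ᵐ s ∂(volume.restrict (Ioc 0 t)), ‖β s‖ ^ 2 ≤ 2 * ν * D * γ s ∧ 0 ≤ γ s :=
      ae_restrict_of_ae_restrict_of_subset (Ioc_subset_Ioc_right ht.2)
        (hT_ae (hbound.and hγ0))
    filter_upwards [hb] with s hs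
    have key := two_mul_re_add_two_mul_im_le hν hD hs.2 (A s) (β s) hs.1
    have e : φ s * F s + F s * φ s + (ψ s * G s + G s * ψ s) =
        2 * (A s).re * (-(ν : ℂ) * A s + β s).re + 2 * (A s).im * (-(ν : ℂ) * A s + β s).im := by
      simp only [hφ, hψ, hF, hG, hφc]
      ring
    rw [e]
    exact key
  -- back to `α`
  filter_upwards [hαA, ae_restrict_mem measurableSet_Ioo] with t ht htT
  rw [ht]
  exact hAbound t ⟨htT.1, htT.2.le⟩

end ModeEnergy

namespace Torus

variable {d : Type*} [Fintype d]

/-! ## Slice toolkit: Plancherel for real slices and bounded multipliers -/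

section Slices

/-- A real `L^p` function on `T^d` is an `L^p` function after the embedding `ℝ ↪ ℂ`. [folklore] -/
private theorem memLp_ofReal' {p : ℝ≥0∞} {f : UnitAddTorus d → ℝ} (hf : MemLp f p volume) :
    MemLp (fun x => (f x : ℂ)) p volume :=
  MemLp.of_le hf (Complex.continuous_ofReal.comp_aestronglyMeasurable hf.1)
    (ae_of_all _ fun x => by rw [Complex.norm_real])

/-- `‖f‖_{L²}² = ∫⁻ ‖f‖ₑ²` for functions with values in a normed group. [folklore] -/
private theorem eLpNorm_two_pow_two' {α : Type*} [MeasurableSpace α] {μ : Measure α}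
    {E : Type*} [NormedAddCommGroup E] (f : α → E) :
    eLpNorm f 2 μ ^ 2 = ∫⁻ x, ‖f x‖ₑ ^ 2 ∂μ := by
  rw [eLpNorm_eq_lintegral_rpow_enorm_toReal two_ne_zero ENNReal.ofNat_ne_top, ENNReal.toReal_ofNat,
    ← ENNReal.rpow_natCast, ← ENNReal.rpow_mul]
  norm_num

/-- **Plancherel for a real `L²` slice, `lintegral` currency**: `∑ₖ ‖𝓕f(k)‖ₑ² = ∫⁻ ‖f‖ₑ²`
(Grafakos 2014, Prop. 3.2.7 (1); the tree's `Torus.tsum_enorm_sq_mFourierCoeff_eq_eLpNorm_sq`).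
[cite: Grafakos2014, Prop. 3.2.7 (1)] -/
theorem tsum_enorm_sq_mFourierCoeff_ofReal_eq_lintegral {f : UnitAddTorus d → ℝ} (hf : MemLp f 2 volume) :
    ∑' k, ‖mFourierCoeff (fun x => (f x : ℂ)) k‖ₑ ^ 2 = ∫⁻ x, ‖f x‖ₑ ^ 2 := by
  rw [FunctionSpaces.Torus.tsum_enorm_sq_mFourierCoeff_eq_eLpNorm_sq (memLp_ofReal' hf),
    eLpNorm_two_pow_two']
  refine lintegral_congr fun x => ?_
  rw [← ofReal_norm, ← ofReal_norm, Complex.norm_real]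

/-- **A bounded multiplier costs at most its bound in `L²`, Fourier side**: for `f ∈ L²(T^d)` real
and a measurable field `v` with `‖v‖ ≤ M` a.e., each product `f vⱼ` is in `L²` and
`∑ₖ ‖𝓕(f vⱼ)(k)‖ₑ² ≤ M² ∫⁻ ‖f‖ₑ²` (Plancherel). [cite: Grafakos2014, Prop. 3.2.7 (1)] -/
theorem tsum_enorm_sq_mFourierCoeff_mul_le {f : UnitAddTorus d → ℝ} (hf : MemLp f 2 volume)
    {v : UnitAddTorus d → EuclideanSpace ℝ d} (hv : AEStronglyMeasurable v volume) {M : ℝ} (hM : 0 ≤ M)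
    (hvM : ∀ᵐ x ∂volume, ‖v x‖ ≤ M) (j : d) :
    MemLp (fun x => f x * v x j) 2 volume ∧
      ∑' k, ‖mFourierCoeff (fun x => ((f x * v x j : ℝ) : ℂ)) k‖ₑ ^ 2 ≤ ENNReal.ofReal (M ^ 2) * ∫⁻ x, ‖f x‖ₑ ^ 2 := by
  have hvj : AEStronglyMeasurable (fun x => v x j) volume :=
    (EuclideanSpace.proj j).continuous.comp_aestronglyMeasurable hv
  have hle : ∀ᵐ x ∂volume, ‖f x * v x j‖ ≤ M * ‖f x‖ := by
    filter_upwards [hvM] with x hx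
    rw [norm_mul, mul_comm]
    refine mul_le_mul_of_nonneg_right ?_ (norm_nonneg _)
    exact (Real.norm_eq_abs _ ▸ FunctionSpaces.Torus.abs_apply_le_norm (v x) j).trans hx
  have hmem : MemLp (fun x => f x * v x j) 2 volume := MemLp.of_le_mul hf (hf.1.mul hvj) hle
  refine ⟨hmem, ?_⟩
  rw [tsum_enorm_sq_mFourierCoeff_ofReal_eq_lintegral hmem]
  calc ∫⁻ x, ‖f x * v x j‖ₑ ^ 2 ≤ ∫⁻ x, (ENNReal.ofReal M * ‖f x‖ₑ) ^ 2 := by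
        refine lintegral_mono_ae ?_
        filter_upwards [hle] with x hx
        gcongr
        rw [← ofReal_norm, ← ofReal_norm, ← ENNReal.ofReal_mul hM]
        exact ENNReal.ofReal_le_ofReal hx
    _ = ENNReal.ofReal (M ^ 2) * ∫⁻ x, ‖f x‖ₑ ^ 2 := by
        rw [← lintegral_const_mul' _ _ (by simp)]
        refine lintegral_congr fun x => ?_
        rw [mul_pow, ENNReal.ofReal_pow hM]

/-- An `L^∞` bound on the space–time lift is an a.e. bound on `(0,T) × T^d`. [folklore] -/
private theorem ae_norm_le_prod_of_memLp_top_stLift' {u : ℝ → UnitAddTorus d → EuclideanSpace ℝ d} {T : ℝ}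
    (hu : MemLp (FunctionSpaces.Torus.stLift u) ∞ (volume.restrict (Ioo 0 T ×ˢ univ))) :
    ∃ M : ℝ, 0 ≤ M ∧ ∀ᵐ q ∂(((volume : Measure ℝ).restrict (Ioo 0 T)).prod (volume : Measure (UnitAddTorus d))),
      ‖u q.1 q.2‖ ≤ M := by
  set μ' : Measure (ℝ × EuclideanSpace ℝ d) := volume.restrict (Ioo 0 T ×ˢ univ) with hμ'
  set M : ℝ := (eLpNorm (FunctionSpaces.Torus.stLift u) ∞ μ').toReal with hM
  have hfin : eLpNorm (FunctionSpaces.Torus.stLift u) ∞ μ' < (⊤ : ℝ≥0∞) := hu.eLpNorm_lt_top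
  have hae' : ∀ᵐ p ∂μ', ‖FunctionSpaces.Torus.stLift u p‖ ≤ M := by
    filter_upwards [ae_le_eLpNormEssSup (f := FunctionSpaces.Torus.stLift u) (μ := μ')] with p hp
    rw [← eLpNorm_exponent_top] at hp
    have := ENNReal.toReal_mono hfin.ne hp
    rwa [toReal_enorm] at this
  refine ⟨M, ENNReal.toReal_nonneg, ?_⟩
  have hprod : μ' = ((volume : Measure ℝ).restrict (Ioo 0 T)).prod volume := by
    rw [hμ', Measure.volume_eq_prod, ← Measure.prod_restrict, Measure.restrict_univ]
  rw [hprod] at hae'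
  have hq := MeasureTheory.QuasiMeasurePreserving.prodMap
    (Measure.QuasiMeasurePreserving.id ((volume : Measure ℝ).restrict (Ioo 0 T)))
    (FunctionSpaces.Torus.quasiMeasurePreserving_repr (d := d))
  filter_upwards [hq.ae hae'] with q hq'
  simpa [FunctionSpaces.Torus.stLift] using hq'

end Slices

/-! ## Arithmetic of the modewise right-hand side -/

section ModeArithmetic

/-- `|k|² min aᵢ ≤ ∑ᵢ aᵢ kᵢ²`. [folklore] -/
private theorem mul_freqNormSq_le_sum {a : d → ℝ} {amin : ℝ} (ha : ∀ i, amin ≤ a i) (k : d → ℤ) :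
    amin * FunctionSpaces.Torus.freqNormSq k ≤ ∑ i, a i * (k i : ℝ) ^ 2 := by
  rw [FunctionSpaces.Torus.freqNormSq, Finset.mul_sum]
  exact Finset.sum_le_sum fun i _ => mul_le_mul_of_nonneg_right (ha i) (sq_nonneg _)

/-- **The transport term of one mode is controlled by the diffusion symbol**: for coefficients
`cⱼ ∈ ℂ`, `‖∑ⱼ 2πi kⱼ cⱼ‖² ≤ 4π² |k|² ∑ⱼ ‖cⱼ‖²` (Cauchy–Schwarz), and `4π²|k|² ≤ νₖ/(κ min aᵢ)` with
`νₖ = 4π²κ ∑ᵢ aᵢkᵢ²`; packaged as `‖β‖² ≤ 2 νₖ (2κ min aᵢ)⁻¹ ∑ⱼ ‖cⱼ‖²`. [folklore] -/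
private theorem norm_sq_sum_mode_le {a : d → ℝ} {amin κ : ℝ} (hamin : 0 < amin) (hκ : 0 < κ)
    (ha : ∀ i, amin ≤ a i) (k : d → ℤ) (c : d → ℂ) :
    ‖-∑ j, (2 * Real.pi * I * (k j)) * c j‖ ^ 2 ≤
      2 * (4 * Real.pi ^ 2 * κ * ∑ i, a i * (k i : ℝ) ^ 2) * (1 / (2 * κ * amin)) * ∑ j, ‖c j‖ ^ 2 := by
  have h1 : ‖-∑ j, (2 * Real.pi * I * (k j)) * c j‖ ≤ ∑ j, (2 * Real.pi * |(k j : ℝ)|) * ‖c j‖ := by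
    rw [norm_neg]
    refine (norm_sum_le _ _).trans (Finset.sum_le_sum fun j _ => ?_)
    rw [norm_mul]
    gcongr
    rw [norm_mul, norm_mul, norm_mul, Complex.norm_I, mul_one, Complex.norm_intCast, Complex.norm_real,
      Real.norm_eq_abs, abs_of_pos Real.pi_pos, ← Int.cast_abs, Int.cast_abs]
    norm_num
  have h2 : (∑ j, (2 * Real.pi * |(k j : ℝ)|) * ‖c j‖) ^ 2 ≤
      (∑ j, (2 * Real.pi * |(k j : ℝ)|) ^ 2) * ∑ j, ‖c j‖ ^ 2 :=
    Finset.sum_mul_sq_le_sq_mul_sq _ _ _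
  have h3 : ∑ j, (2 * Real.pi * |(k j : ℝ)|) ^ 2 = 4 * Real.pi ^ 2 * FunctionSpaces.Torus.freqNormSq k := by
    rw [FunctionSpaces.Torus.freqNormSq, Finset.mul_sum]
    exact Finset.sum_congr rfl fun j _ => by rw [mul_pow, sq_abs]; ring
  have h4 : 4 * Real.pi ^ 2 * FunctionSpaces.Torus.freqNormSq k ≤
      2 * (4 * Real.pi ^ 2 * κ * ∑ i, a i * (k i : ℝ) ^ 2) * (1 / (2 * κ * amin)) := by
    have e : 2 * (4 * Real.pi ^ 2 * κ * ∑ i, a i * (k i : ℝ) ^ 2) * (1 / (2 * κ * amin)) =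
        4 * Real.pi ^ 2 * ((∑ i, a i * (k i : ℝ) ^ 2) / amin) := by
      field_simp
    rw [e]
    refine mul_le_mul_of_nonneg_left ?_ (by positivity)
    rw [le_div_iff₀ hamin, mul_comm]
    exact mul_freqNormSq_le_sum ha k
  have h0 : 0 ≤ ∑ j, (2 * Real.pi * |(k j : ℝ)|) * ‖c j‖ :=
    Finset.sum_nonneg fun j _ => by positivity
  calc ‖-∑ j, (2 * Real.pi * I * (k j)) * c j‖ ^ 2 ≤ (∑ j, (2 * Real.pi * |(k j : ℝ)|) * ‖c j‖) ^ 2 :=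
        pow_le_pow_left₀ (norm_nonneg _) h1 2
    _ ≤ (∑ j, (2 * Real.pi * |(k j : ℝ)|) ^ 2) * ∑ j, ‖c j‖ ^ 2 := h2
    _ ≤ 2 * (4 * Real.pi ^ 2 * κ * ∑ i, a i * (k i : ℝ) ^ 2) * (1 / (2 * κ * amin)) * ∑ j, ‖c j‖ ^ 2 := by
        rw [h3]
        exact mul_le_mul_of_nonneg_right h4 (Finset.sum_nonneg fun j _ => sq_nonneg _)

end ModeArithmetic

/-! ## The modewise energy bound for a weak solution with datum `0` -/

section ModeBound

variable [DecidableEq d]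

namespace IsWeakScalarTransportDiagOn

variable {T κ : ℝ} {a : d → ℝ} {u : ℝ → UnitAddTorus d → EuclideanSpace ℝ d} {θ : ℝ → UnitAddTorus d → ℝ}

omit [DecidableEq d] in
/-- The Fourier coefficients of the zero datum vanish. [folklore] -/
private theorem mFourierCoeff_zero_datum (k : d → ℤ) :
    mFourierCoeff (fun x : UnitAddTorus d => (((0 : UnitAddTorus d → ℝ) x : ℝ) : ℂ)) k = 0 := by
  rw [FunctionSpaces.Torus.mFourierCoeff_eq_integral_volume]
  simp

/-- **Uniform-in-`k` modewise energy bound.** For a weak solution of the homogeneous diagonal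
equation with datum `0`, `κ > 0`, coefficients `aᵢ ≥ amin > 0` and a drift bounded by `M` a.e. on
`(0,T) × T^d`: for every `k` and a.e. `t ∈ (0,T)`,
`‖𝓕θ(t)(k)‖² ≤ (2κ amin)⁻¹ ∫_{(0,t]} ∑ⱼ ‖𝓕(θ uⱼ)(τ)(k)‖² dτ`
(`sq_norm_le_of_ae_eq_setIntegral` applied to the modewise integral equation, with
`norm_sq_sum_mode_le`; the Galerkin energy estimate of Evans 2010, §7.1.2, Thm. 2, one mode at a
time, with the transport term put on the right-hand side). [cite: Evans2010, §7.1.2 Thm. 2] -/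
theorem ae_sq_norm_mFourierCoeff_le (h : IsWeakScalarTransportDiagOn T a κ u 0 θ) (hκ : 0 < κ)
    {amin : ℝ} (hamin : 0 < amin) (ha : ∀ i, amin ≤ a i) {M : ℝ} (hM : 0 ≤ M)
    (huM : ∀ᵐ q ∂(((volume : Measure ℝ).restrict (Ioo 0 T)).prod (volume : Measure (UnitAddTorus d))),
      ‖u q.1 q.2‖ ≤ M) (k : d → ℤ) :
    ∀ᵐ t ∂(volume.restrict (Ioo 0 T)),
      ‖mFourierCoeff (fun x => (θ t x : ℂ)) k‖ ^ 2 ≤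
        (1 / (2 * κ * amin)) * ∫ τ in Ioc 0 t, ∑ j, ‖mFourierCoeff (fun x => ((θ τ x * u τ x j : ℝ) : ℂ)) k‖ ^ 2 := by
  have h' : IsWeakScalarTransportDiagForcedOn T a κ u 0 0 θ := isWeakScalarTransportDiagForcedOn_zero_iff.2 h
  obtain ⟨C, hC⟩ := h.ae_lintegral_sq_le
  -- the data of the one-mode lemma
  set ν : ℝ := 4 * Real.pi ^ 2 * κ * ∑ i, a i * (k i : ℝ) ^ 2 with hν
  set D : ℝ := 1 / (2 * κ * amin) with hD
  set α : ℝ → ℂ := fun t => mFourierCoeff (fun x => (θ t x : ℂ)) k with hα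
  set c : d → ℝ → ℂ := fun j τ => mFourierCoeff (fun x => ((θ τ x * u τ x j : ℝ) : ℂ)) k with hc
  set β : ℝ → ℂ := fun τ => -∑ j, (2 * Real.pi * I * (k j)) * c j τ with hβ
  set γ : ℝ → ℝ := fun τ => ∑ j, ‖c j τ‖ ^ 2 with hγ
  have hν0 : 0 ≤ ν := by
    have : 0 ≤ ∑ i, a i * (k i : ℝ) ^ 2 :=
      Finset.sum_nonneg fun i _ => mul_nonneg (hamin.le.trans (ha i)) (sq_nonneg _)
    positivity
  have hD0 : 0 ≤ D := by positivity
  have hαi : IntegrableOn α (Ioo 0 T) := h'.integrableOn_mFourierCoeff k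
  have hci : ∀ j, IntegrableOn (c j) (Ioo 0 T) := fun j => h'.integrableOn_mFourierCoeff_mul_velocity k j
  have hβi : IntegrableOn β (Ioo 0 T) := (integrable_finsetSum _ fun j _ => (hci j).const_mul _).neg
  -- slice facts: `θ(τ) ∈ L²`, `∫ |θ(τ)|² ≤ C`, `‖u(τ, ·)‖ ≤ M` a.e.
  have hslice : ∀ᵐ τ ∂(volume.restrict (Ioo 0 T)), MemLp (θ τ) 2 volume ∧ (∫⁻ x, ‖θ τ x‖ₑ ^ 2 ≤ C) ∧
      AEStronglyMeasurable (u τ) volume ∧ ∀ᵐ x ∂volume, ‖u τ x‖ ≤ M := by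
    filter_upwards [h'.ae_memLp_two, hC, h'.aestronglyMeasurable_uncurry_velocity.prodMk_left,
      Measure.ae_ae_of_ae_prod huM] with τ h1 h2 h3 h4
    exact ⟨h1, h2, h3, h4⟩
  -- hence `‖c j τ‖² ≤ M² C` a.e., so `γ` is integrable
  have hcb : ∀ j, ∀ᵐ τ ∂(volume.restrict (Ioo 0 T)), ‖c j τ‖ ^ 2 ≤ M ^ 2 * C := by
    intro j
    filter_upwards [hslice] with τ hτ
    have hP := (tsum_enorm_sq_mFourierCoeff_mul_le hτ.1 hτ.2.2.1 hM hτ.2.2.2 j).2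
    have h1 : ‖c j τ‖ₑ ^ 2 ≤ ENNReal.ofReal (M ^ 2) * C :=
      ((ENNReal.le_tsum k).trans hP).trans (mul_le_mul_right hτ.2.1 _)
    have h2 : ‖c j τ‖ₑ ^ 2 = ENNReal.ofReal (‖c j τ‖ ^ 2) := by
      rw [← ofReal_norm, ENNReal.ofReal_pow (norm_nonneg _)]
    rw [h2, ← ENNReal.ofReal_coe_nnreal, ← ENNReal.ofReal_mul (sq_nonneg _)] at h1
    exact (ENNReal.ofReal_le_ofReal_iff (by positivity)).1 h1
  have hγi : IntegrableOn γ (Ioo 0 T) := by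
    have hm : AEStronglyMeasurable γ (volume.restrict (Ioo 0 T)) :=
      Finset.aestronglyMeasurable_fun_sum _ fun j _ => ((hci j).aestronglyMeasurable.norm.pow 2)
    refine IntegrableOn.of_bound measure_Ioo_lt_top hm (∑ _j : d, M ^ 2 * C) ?_
    have hall : ∀ᵐ τ ∂(volume.restrict (Ioo 0 T)), ∀ j, ‖c j τ‖ ^ 2 ≤ M ^ 2 * C :=
      ae_all_iff.2 fun j => hcb j
    filter_upwards [hall] with τ hτ
    rw [Real.norm_eq_abs, abs_of_nonneg (Finset.sum_nonneg fun j _ => sq_nonneg _)]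
    exact Finset.sum_le_sum fun j _ => hτ j
  have hγ0 : ∀ᵐ τ ∂(volume.restrict (Ioo 0 T)), 0 ≤ γ τ :=
    ae_of_all _ fun τ => Finset.sum_nonneg fun j _ => sq_nonneg _
  -- the modewise integral equation with datum `0`
  have heq : ∀ᵐ t ∂(volume.restrict (Ioo 0 T)), α t = ∫ τ in Ioc 0 t, (-(ν : ℂ) * α τ + β τ) := by
    filter_upwards [h.ae_mFourierCoeff_eq (integrable_zero _ _ _) k] with t ht
    rw [hα]
    simp only
    rw [ht, mFourierCoeff_zero_datum, zero_add]
    refine integral_congr_ae (ae_of_all _ fun τ => ?_)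
    simp only [hβ, hc, hν]
    ring
  -- the bound on `β`
  have hbound : ∀ᵐ τ ∂(volume.restrict (Ioo 0 T)), ‖β τ‖ ^ 2 ≤ 2 * ν * D * γ τ :=
    ae_of_all _ fun τ => norm_sq_sum_mode_le hamin hκ ha k (fun j => c j τ)
  exact sq_norm_le_of_ae_eq_setIntegral hν0 hD0 hαi hβi hγi hγ0 heq hbound

/-- **A weak solution of the homogeneous diagonal equation with datum `0` and bounded drift
vanishes** (`κ > 0`, all `aᵢ > 0`, `u ∈ L^∞((0,T) × T^d)`): `θ(t) = 0` a.e. for a.e. `t ∈ (0,T)`.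
Summing the modewise bounds `ae_sq_norm_mFourierCoeff_le` over `k` (Plancherel, Tonelli) gives
`‖θ(t)‖²_{L²} ≤ (d M²/(2κ min aᵢ)) ∫₀ᵗ ‖θ‖²_{L²}` for a.e. `t`, and Grönwall a.e. in time
(`ae_gronwall_const`) concludes. [cite: BonicattoCiampaCrippa2023, Cor. 3.5 (case p = ∞, q = 2)] -/
theorem ae_eq_zero_of_memLp_top (h : IsWeakScalarTransportDiagOn T a κ u 0 θ) (hκ : 0 < κ)
    (ha : ∀ i, 0 < a i)
    (hu : MemLp (FunctionSpaces.Torus.stLift u) ∞ (volume.restrict (Ioo 0 T ×ˢ univ))) :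
    ∀ᵐ t ∂(volume.restrict (Ioo 0 T)), θ t =ᵐ[volume] 0 := by
  have h' : IsWeakScalarTransportDiagForcedOn T a κ u 0 0 θ := isWeakScalarTransportDiagForcedOn_zero_iff.2 h
  -- a positive lower bound of the coefficients (vacuous if `d` is empty)
  obtain ⟨amin, hamin, hle⟩ : ∃ amin : ℝ, 0 < amin ∧ ∀ i, amin ≤ a i := by
    by_cases hd : Nonempty d
    · obtain ⟨i₀, -, hi₀⟩ := Finset.exists_min_image Finset.univ a Finset.univ_nonempty
      exact ⟨a i₀, ha i₀, fun i => hi₀ i (Finset.mem_univ i)⟩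
    · haveI : IsEmpty d := not_nonempty_iff.1 hd
      exact ⟨1, one_pos, fun i => isEmptyElim i⟩
  obtain ⟨M, hM, huM⟩ := ae_norm_le_prod_of_memLp_top_stLift' hu
  obtain ⟨C, hC⟩ := h.ae_lintegral_sq_le
  set D : ℝ := 1 / (2 * κ * amin) with hD
  have hD0 : 0 ≤ D := by positivity
  set Φ : ℝ → ℝ≥0∞ := fun t => ∫⁻ x, ‖θ t x‖ₑ ^ 2 with hΦ
  set c : d → (d → ℤ) → ℝ → ℂ := fun j k τ => mFourierCoeff (fun x => ((θ τ x * u τ x j : ℝ) : ℂ)) k with hc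
  have hci : ∀ j k, IntegrableOn (c j k) (Ioo 0 T) := fun j k => h'.integrableOn_mFourierCoeff_mul_velocity k j
  -- slice facts
  have hslice : ∀ᵐ τ ∂(volume.restrict (Ioo 0 T)), MemLp (θ τ) 2 volume ∧
      AEStronglyMeasurable (u τ) volume ∧ ∀ᵐ x ∂volume, ‖u τ x‖ ≤ M := by
    filter_upwards [h'.ae_memLp_two, h'.aestronglyMeasurable_uncurry_velocity.prodMk_left,
      Measure.ae_ae_of_ae_prod huM] with τ h1 h3 h4
    exact ⟨h1, h3, h4⟩
  -- Plancherel bound for the fluxes: `∑ₖ ∑ⱼ ‖c j k τ‖ₑ² ≤ d M² Φ τ` a.e.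
  have hflux : ∀ᵐ τ ∂(volume.restrict (Ioo 0 T)),
      ∑' k, ∑ j, ‖c j k τ‖ₑ ^ 2 ≤ (Fintype.card d : ℝ≥0∞) * (ENNReal.ofReal (M ^ 2) * Φ τ) := by
    filter_upwards [hslice] with τ hτ
    rw [Summable.tsum_finsetSum (fun _ _ => ENNReal.summable)]
    calc ∑ j, ∑' k, ‖c j k τ‖ₑ ^ 2 ≤ ∑ _j : d, ENNReal.ofReal (M ^ 2) * Φ τ :=
          Finset.sum_le_sum fun j _ => (tsum_enorm_sq_mFourierCoeff_mul_le hτ.1 hτ.2.1 hM hτ.2.2 j).2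
      _ = (Fintype.card d : ℝ≥0∞) * (ENNReal.ofReal (M ^ 2) * Φ τ) := by
          rw [Finset.sum_const, Finset.card_univ, nsmul_eq_mul]
  -- all modewise bounds at once
  have hmodes : ∀ᵐ t ∂(volume.restrict (Ioo 0 T)), ∀ k : d → ℤ,
      ‖mFourierCoeff (fun x => (θ t x : ℂ)) k‖ ^ 2 ≤ D * ∫ τ in Ioc 0 t, ∑ j, ‖c j k τ‖ ^ 2 :=
    ae_all_iff.2 fun k => h.ae_sq_norm_mFourierCoeff_le hκ hamin hle hM huM k
  -- integrability of the `γₖ` (as in the modewise lemma)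
  have hγi : ∀ k, IntegrableOn (fun τ => ∑ j, ‖c j k τ‖ ^ 2) (Ioo 0 T) := by
    intro k
    have hm : AEStronglyMeasurable (fun τ => ∑ j, ‖c j k τ‖ ^ 2) (volume.restrict (Ioo 0 T)) :=
      Finset.aestronglyMeasurable_fun_sum _ fun j _ => ((hci j k).aestronglyMeasurable.norm.pow 2)
    refine IntegrableOn.of_bound measure_Ioo_lt_top hm (∑ _j : d, M ^ 2 * C) ?_
    filter_upwards [hslice, hC] with τ hτ hτC
    rw [Real.norm_eq_abs, abs_of_nonneg (Finset.sum_nonneg fun j _ => sq_nonneg _)]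
    refine Finset.sum_le_sum fun j _ => ?_
    have hP := (tsum_enorm_sq_mFourierCoeff_mul_le hτ.1 hτ.2.1 hM hτ.2.2 j).2
    have h1 : ‖c j k τ‖ₑ ^ 2 ≤ ENNReal.ofReal (M ^ 2) * C :=
      ((ENNReal.le_tsum k).trans hP).trans (mul_le_mul_right hτC _)
    have h2 : ‖c j k τ‖ₑ ^ 2 = ENNReal.ofReal (‖c j k τ‖ ^ 2) := by
      rw [← ofReal_norm, ENNReal.ofReal_pow (norm_nonneg _)]
    rw [h2, ← ENNReal.ofReal_coe_nnreal, ← ENNReal.ofReal_mul (sq_nonneg _)] at h1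
    exact (ENNReal.ofReal_le_ofReal_iff (by positivity)).1 h1
  -- the integral inequality for `Φ`
  set L : ℝ≥0∞ := ENNReal.ofReal D * ((Fintype.card d : ℝ≥0∞) * ENNReal.ofReal (M ^ 2)) with hL
  have hLtop : L ≠ ⊤ := by
    rw [hL]
    exact ENNReal.mul_ne_top ENNReal.ofReal_ne_top
      (ENNReal.mul_ne_top (ENNReal.natCast_ne_top _) ENNReal.ofReal_ne_top)
  have hΦ : ∀ᵐ t ∂(volume.restrict (Ioo 0 T)), Φ t ≤ 0 + L * ∫⁻ τ in Ioo 0 t, Φ τ := by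
    filter_upwards [hmodes, hslice, ae_restrict_mem measurableSet_Ioo] with t ht hts htT
    rw [zero_add]
    have hsub : Ioc 0 t ⊆ Ioo 0 T := fun τ hτ => ⟨hτ.1, hτ.2.trans_lt htT.2⟩
    -- `Φ t = ∑ₖ ‖θ̂ₖ(t)‖ₑ²`
    rw [hΦ]
    simp only
    rw [← tsum_enorm_sq_mFourierCoeff_ofReal_eq_lintegral hts.1]
    -- modewise
    have hk : ∀ k, ‖mFourierCoeff (fun x => (θ t x : ℂ)) k‖ₑ ^ 2 ≤
        ENNReal.ofReal D * ∫⁻ τ in Ioc 0 t, ∑ j, ‖c j k τ‖ₑ ^ 2 := by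
      intro k
      have hγt : Integrable (fun τ => ∑ j, ‖c j k τ‖ ^ 2) (volume.restrict (Ioc 0 t)) :=
        (hγi k).mono_set hsub
      have e1 : ‖mFourierCoeff (fun x => (θ t x : ℂ)) k‖ₑ ^ 2 =
          ENNReal.ofReal (‖mFourierCoeff (fun x => (θ t x : ℂ)) k‖ ^ 2) := by
        rw [← ofReal_norm, ENNReal.ofReal_pow (norm_nonneg _)]
      have e2 : ∫⁻ τ in Ioc 0 t, ∑ j, ‖c j k τ‖ₑ ^ 2 = ∫⁻ τ in Ioc 0 t, ENNReal.ofReal (∑ j, ‖c j k τ‖ ^ 2) := by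
        refine lintegral_congr fun τ => ?_
        rw [ENNReal.ofReal_sum_of_nonneg (fun j _ => sq_nonneg _)]
        refine Finset.sum_congr rfl fun j _ => ?_
        rw [← ofReal_norm, ENNReal.ofReal_pow (norm_nonneg _)]
      rw [e1, e2, ← ofReal_integral_eq_lintegral_ofReal hγt (ae_of_all _ fun τ => Finset.sum_nonneg fun j _ => sq_nonneg _),
        ← ENNReal.ofReal_mul hD0]
      exact ENNReal.ofReal_le_ofReal (ht k)
    -- sum over `k` and exchange with the time integral
    have hmeas : ∀ k, AEMeasurable (fun τ => ∑ j, ‖c j k τ‖ₑ ^ 2) (volume.restrict (Ioc 0 t)) := by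
      intro k
      refine (Finset.aemeasurable_fun_sum _ fun j _ => ?_)
      exact (((hci j k).aestronglyMeasurable.aemeasurable.mono_set hsub).enorm.pow_const 2)
    calc ∑' k, ‖mFourierCoeff (fun x => (θ t x : ℂ)) k‖ₑ ^ 2
        ≤ ∑' k, ENNReal.ofReal D * ∫⁻ τ in Ioc 0 t, ∑ j, ‖c j k τ‖ₑ ^ 2 := ENNReal.tsum_le_tsum hk
      _ = ENNReal.ofReal D * ∫⁻ τ in Ioc 0 t, ∑' k, ∑ j, ‖c j k τ‖ₑ ^ 2 := by
          rw [ENNReal.tsum_mul_left, lintegral_tsum hmeas]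
      _ ≤ ENNReal.ofReal D * ∫⁻ τ in Ioc 0 t, (Fintype.card d : ℝ≥0∞) * (ENNReal.ofReal (M ^ 2) * Φ τ) := by
          gcongr 1
          exact lintegral_mono_ae (ae_restrict_of_ae_restrict_of_subset hsub hflux)
      _ = L * ∫⁻ τ in Ioo 0 t, Φ τ := by
          rw [lintegral_const_mul' _ _ (ENNReal.natCast_ne_top _), lintegral_const_mul' _ _ ENNReal.ofReal_ne_top,
            setLIntegral_congr (Ioo_ae_eq_Ioc (μ := (volume : Measure ℝ))), hL]
          ring
  have hΦC : ∀ᵐ t ∂(volume.restrict (Ioo 0 T)), Φ t ≤ (C : ℝ≥0∞) := hC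
  have hG := ae_gronwall_const (S := T) (φ := Φ) (B := 0) (M := C) (L := L) (by simp) ENNReal.coe_ne_top hLtop hΦC hΦ
  -- conclusion
  filter_upwards [hG, h'.aestronglyMeasurable_uncurry.prodMk_left] with t ht hm
  have h0 : Φ t = 0 := le_antisymm (by simpa using ht) bot_le
  have hae : ∀ᵐ x ∂volume, ‖θ t x‖ₑ ^ 2 = 0 :=
    (lintegral_eq_zero_iff' (hm.enorm.pow_const 2)).1 h0
  filter_upwards [hae] with x hx
  have hx' : ‖θ t x‖ₑ = 0 := by simpa using hx
  simpa [enorm_eq_zero] using hx'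

end IsWeakScalarTransportDiagOn

end ModeBound

/-! ## Uniqueness -/

section Uniqueness

variable [DecidableEq d]

namespace IsWeakScalarTransportDiagForcedOn

variable {T κ : ℝ} {a : d → ℝ} {u : ℝ → UnitAddTorus d → EuclideanSpace ℝ d} {s : ℝ → UnitAddTorus d → ℝ}
  {θ₀ : UnitAddTorus d → ℝ} {θ₁ θ₂ : ℝ → UnitAddTorus d → ℝ}

/-- `‖u‖ (θ₁ - θ₂) ∈ L¹((0,T) × T^d)` in the iterated-`lintegral` form of the solution class.
[cite: DiPernaLions1989, §II.1] -/
theorem lintegral_mul_sub_lt_top (h₁ : IsWeakScalarTransportDiagForcedOn T a κ u s θ₀ θ₁)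
    (h₂ : IsWeakScalarTransportDiagForcedOn T a κ u s θ₀ θ₂) :
    ∫⁻ t in Ioo 0 T, ∫⁻ x, ‖u t x‖ₑ * ‖θ₁ t x - θ₂ t x‖ₑ < ⊤ := by
  set μT : Measure ℝ := (volume : Measure ℝ).restrict (Ioo 0 T) with hμT
  have hmu := h₁.aestronglyMeasurable_uncurry_velocity
  have hm₁ := h₁.aestronglyMeasurable_uncurry
  have hm₂ := h₂.aestronglyMeasurable_uncurry
  have hF : AEMeasurable (fun p : ℝ × UnitAddTorus d => ‖u p.1 p.2‖ₑ * ‖θ₁ p.1 p.2 - θ₂ p.1 p.2‖ₑ)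
      (μT.prod volume) := hmu.enorm.mul (hm₁.sub hm₂).enorm
  have hF₁ : AEMeasurable (fun p : ℝ × UnitAddTorus d => ‖u p.1 p.2‖ₑ * ‖θ₁ p.1 p.2‖ₑ) (μT.prod volume) :=
    hmu.enorm.mul hm₁.enorm
  have hF₂ : AEMeasurable (fun p : ℝ × UnitAddTorus d => ‖u p.1 p.2‖ₑ * ‖θ₂ p.1 p.2‖ₑ) (μT.prod volume) :=
    hmu.enorm.mul hm₂.enorm
  have e : ∫⁻ t in Ioo 0 T, ∫⁻ x, ‖u t x‖ₑ * ‖θ₁ t x - θ₂ t x‖ₑ =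
      ∫⁻ p, ‖u p.1 p.2‖ₑ * ‖θ₁ p.1 p.2 - θ₂ p.1 p.2‖ₑ ∂(μT.prod volume) := (lintegral_prod _ hF).symm
  rw [e]
  calc ∫⁻ p, ‖u p.1 p.2‖ₑ * ‖θ₁ p.1 p.2 - θ₂ p.1 p.2‖ₑ ∂(μT.prod volume)
      ≤ ∫⁻ p, (‖u p.1 p.2‖ₑ * ‖θ₁ p.1 p.2‖ₑ + ‖u p.1 p.2‖ₑ * ‖θ₂ p.1 p.2‖ₑ) ∂(μT.prod volume) := by
        refine lintegral_mono fun p => ?_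
        rw [← mul_add]
        gcongr
        exact enorm_sub_le
    _ = (∫⁻ p, ‖u p.1 p.2‖ₑ * ‖θ₁ p.1 p.2‖ₑ ∂(μT.prod volume)) +
          ∫⁻ p, ‖u p.1 p.2‖ₑ * ‖θ₂ p.1 p.2‖ₑ ∂(μT.prod volume) := lintegral_add_left' hF₁ _
    _ = (∫⁻ t in Ioo 0 T, ∫⁻ x, ‖u t x‖ₑ * ‖θ₁ t x‖ₑ) + ∫⁻ t in Ioo 0 T, ∫⁻ x, ‖u t x‖ₑ * ‖θ₂ t x‖ₑ := by
        rw [lintegral_prod _ hF₁, lintegral_prod _ hF₂]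
    _ < ⊤ := ENNReal.add_lt_top.2 ⟨h₁.lintegral_mul_lt_top, h₂.lintegral_mul_lt_top⟩

/-- `θ₁ - θ₂ ∈ L^∞(0,T; L²)`: `∫ |θ₁(t) - θ₂(t)|² ≤ (C₁ + C₂)²` for a.e. `t`.
[cite: DiPernaLions1989, §II.1] -/
theorem ae_lintegral_sq_sub_le (h₁ : IsWeakScalarTransportDiagForcedOn T a κ u s θ₀ θ₁)
    (h₂ : IsWeakScalarTransportDiagForcedOn T a κ u s θ₀ θ₂) :
    ∃ C : ℝ≥0, ∀ᵐ t ∂(volume.restrict (Ioo 0 T)), ∫⁻ x, ‖θ₁ t x - θ₂ t x‖ₑ ^ 2 ≤ C := by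
  obtain ⟨C₁, hC₁⟩ := h₁.exists_eLpNorm_le
  obtain ⟨C₂, hC₂⟩ := h₂.exists_eLpNorm_le
  refine ⟨(C₁ + C₂) ^ 2, ?_⟩
  filter_upwards [hC₁, hC₂, h₁.ae_memLp_two, h₂.ae_memLp_two] with t hc₁ hc₂ hm₁ hm₂
  have hsub : eLpNorm (θ₁ t - θ₂ t) 2 volume ≤ C₁ + C₂ :=
    (eLpNorm_sub_le hm₁.1 hm₂.1 one_le_two).trans (add_le_add hc₁ hc₂)
  have e : ∫⁻ x, ‖θ₁ t x - θ₂ t x‖ₑ ^ 2 = eLpNorm (θ₁ t - θ₂ t) 2 volume ^ 2 := by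
    rw [eLpNorm_two_pow_two']
    rfl
  rw [e, ENNReal.coe_pow, ENNReal.coe_add]
  exact pow_le_pow_left' hsub 2

/-- **Linearity of the sourced diagonal weak class**: the difference of two weak solutions of
`∂ₜθ + u·∇θ = κ ∑ᵢ aᵢ ∂ᵢ∂ᵢθ + s` with the same drift, source and datum is a weak solution of the
homogeneous equation with datum `0`. [cite: DiPernaLions1989, §II.1] -/
theorem sub_of_eq (h₁ : IsWeakScalarTransportDiagForcedOn T a κ u s θ₀ θ₁)
    (h₂ : IsWeakScalarTransportDiagForcedOn T a κ u s θ₀ θ₂) :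
    IsWeakScalarTransportDiagOn T a κ u 0 (fun t x => θ₁ t x - θ₂ t x) where
  aestronglyMeasurable := h₁.aestronglyMeasurable.sub h₂.aestronglyMeasurable
  aestronglyMeasurable_velocity := h₁.aestronglyMeasurable_velocity
  ae_lintegral_sq_le := ae_lintegral_sq_sub_le h₁ h₂
  lintegral_velocity_lt_top := h₁.lintegral_velocity_lt_top
  lintegral_mul_lt_top := lintegral_mul_sub_lt_top h₁ h₂
  ae_isWeaklyDivFree := h₁.ae_isWeaklyDivFree
  weak_eq ψ hψ := by
    have e₁ := h₁.weak_eq ψ hψ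
    have e₂ := h₂.weak_eq ψ hψ
    have hI₁ := h₁.integrable_weakIntegrand hψ
    have hI₂ := h₂.integrable_weakIntegrand hψ
    have hslice : ∀ᵐ t ∂(volume.restrict (Ioo 0 T)),
        ∫ x, (θ₁ t x - θ₂ t x) * (FunctionSpaces.Torus.timeDeriv ψ t x +
          ⟪u t x, FunctionSpaces.Torus.gradient (ψ t) x⟫_ℝ +
          κ * ∑ i, a i * FunctionSpaces.Torus.partialDeriv i (FunctionSpaces.Torus.partialDeriv i (ψ t)) x) =
        (∫ x, θ₁ t x * (FunctionSpaces.Torus.timeDeriv ψ t x +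
          ⟪u t x, FunctionSpaces.Torus.gradient (ψ t) x⟫_ℝ +
          κ * ∑ i, a i * FunctionSpaces.Torus.partialDeriv i (FunctionSpaces.Torus.partialDeriv i (ψ t)) x)) -
        ∫ x, θ₂ t x * (FunctionSpaces.Torus.timeDeriv ψ t x +
          ⟪u t x, FunctionSpaces.Torus.gradient (ψ t) x⟫_ℝ +
          κ * ∑ i, a i * FunctionSpaces.Torus.partialDeriv i (FunctionSpaces.Torus.partialDeriv i (ψ t)) x) := by
      filter_upwards [hI₁.prod_right_ae, hI₂.prod_right_ae] with t ht₁ ht₂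
      rw [← integral_sub ht₁ ht₂]
      refine integral_congr_ae (Eventually.of_forall fun x => ?_)
      dsimp only
      ring
    rw [integral_congr_ae hslice, integral_sub hI₁.integral_prod_left hI₂.integral_prod_left]
    simp only [Pi.zero_apply, zero_mul, integral_zero, add_zero]
    linarith

/-- **Uniqueness for bounded drift, sourced diagonal equation** (Bonicatto–Ciampa–Crippa 2024,
Cor. 3.5 at `p = ∞`, `q = 2`, transported to `κ ∑ᵢ aᵢ ∂ᵢ∂ᵢ`): for `κ > 0`, all `aᵢ > 0` and
`u ∈ L^∞((0,T) × T^d)`, two weak solutions of `∂ₜθ + u·∇θ = κ ∑ᵢ aᵢ ∂ᵢ∂ᵢθ + s` in `L^∞_t L²_x`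
with the same datum and source coincide for a.e. `t ∈ (0,T)` (their difference solves the
homogeneous problem from datum `0`, `sub_of_eq`, and vanishes by
`IsWeakScalarTransportDiagOn.ae_eq_zero_of_memLp_top`).
[cite: BonicattoCiampaCrippa2023, Cor. 3.5 (case p = ∞, q = 2)] -/
theorem ae_eq_of_memLp_top (hκ : 0 < κ) (ha : ∀ i, 0 < a i)
    (h₁ : IsWeakScalarTransportDiagForcedOn T a κ u s θ₀ θ₁) (h₂ : IsWeakScalarTransportDiagForcedOn T a κ u s θ₀ θ₂)
    (hu : MemLp (FunctionSpaces.Torus.stLift u) ∞ (volume.restrict (Ioo 0 T ×ˢ univ))) :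
    ∀ᵐ t ∂(volume.restrict (Ioo 0 T)), θ₁ t =ᵐ[volume] θ₂ t := by
  filter_upwards [(sub_of_eq h₁ h₂).ae_eq_zero_of_memLp_top hκ ha hu] with t ht
  filter_upwards [ht] with x hx
  exact sub_eq_zero.1 hx

end IsWeakScalarTransportDiagForcedOn

namespace IsWeakScalarTransportDiagOn

variable {T κ : ℝ} {a : d → ℝ} {u : ℝ → UnitAddTorus d → EuclideanSpace ℝ d}
  {θ₀ : UnitAddTorus d → ℝ} {θ₁ θ₂ : ℝ → UnitAddTorus d → ℝ}

/-- **Uniqueness for bounded drift, homogeneous diagonal equation** (Bonicatto–Ciampa–Crippa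
2024, Cor. 3.5 at `p = ∞`, `q = 2`, for `κ ∑ᵢ aᵢ ∂ᵢ∂ᵢ`): for `κ > 0`, all `aᵢ > 0` and
`u ∈ L^∞((0,T) × T^d)`, two weak solutions of `∂ₜθ + u·∇θ = κ ∑ᵢ aᵢ ∂ᵢ∂ᵢθ` in `L^∞_t L²_x` with
the same datum coincide for a.e. `t ∈ (0,T)`. [cite: BonicattoCiampaCrippa2023, Cor. 3.5 (case p = ∞, q = 2)] -/
theorem ae_eq_of_memLp_top (hκ : 0 < κ) (ha : ∀ i, 0 < a i)
    (h₁ : IsWeakScalarTransportDiagOn T a κ u θ₀ θ₁) (h₂ : IsWeakScalarTransportDiagOn T a κ u θ₀ θ₂)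
    (hu : MemLp (FunctionSpaces.Torus.stLift u) ∞ (volume.restrict (Ioo 0 T ×ˢ univ))) :
    ∀ᵐ t ∂(volume.restrict (Ioo 0 T)), θ₁ t =ᵐ[volume] θ₂ t :=
  IsWeakScalarTransportDiagForcedOn.ae_eq_of_memLp_top hκ ha
    (isWeakScalarTransportDiagForcedOn_zero_iff.2 h₁) (isWeakScalarTransportDiagForcedOn_zero_iff.2 h₂) hu

end IsWeakScalarTransportDiagOn

end Uniqueness

end Torus

end Literature.Analysis.FluidPDE

end
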